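/-
Copyright (c) 2026 the pub-hodgecm-mathlib formalisation cell (harness21).  Prover seat hodgecm-mathlib-A-p19 (g26): T3′ P-2 row (R2²) «THE FREE ROW, TYPE (2)» — the ONE-PLACE row
value (D4-place) (road «S3-tree», crux H413).
-/
import Literature.NumberTheory.Rogawski1990.TypeTwoEigenFieldPackage            -- ★ p846663 (D2-β) F0P2-p06 (g11): `exists_eigenField_package` (brings ★ [T2-L] p846635, ★ Q2∕Q5)
import Literature.NumberTheory.LocalFields.InertPlaceSkewDiscriminantRoot         -- ★ p846675 (D2-α) F0P2-p06 (g11): `exists_skew_sqrt_discriminant`, `exists_skew_unit`, `exists_isUnit_galAdicCompletionMap_sub`, `exists_mul_galAdicCompletionMap_mul_eq_one_of_even`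
import Literature.NumberTheory.Automorphic.TypeTwoCommutantBridge                -- ★ p846662 (D3) this seat: `exists_algHom_prod`, `hstar_of_algHom_prod`, `exists_aeval_prod_eq`, `mem_adjoin_integer_iff_exists_mem_map`, `relIndex_units_map_prod_eq`
import Literature.NumberTheory.Automorphic.CyclicSelfDualLatticeTorsor            -- ★ p846576 [T2-a] F0P3b-p01 (g12): `ncard_setOf_selfDual_cyclic_eq_relIndex`, `exists_units_of_mem`
import Literature.NumberTheory.Automorphic.TypeTwoSelfDualCyclicParity           -- ★ p846702 (D2-γ-CM) B-p14 (g37): `exists_selfDual_cyclic_iff_even_log` (★ frame p846649 ∘ ★ seam p846609 ∘ ★ core p846562)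
import Literature.NumberTheory.Automorphic.ValuedFieldValuativeRelBridge          -- ★ `v_eq_iff_valuation_eq`, `v_le_one_iff_mem_integer`, …
import Literature.NumberTheory.NumberFields.QuadraticRamifiedAtOddValuationPlace  -- ★ Q3∕QM: `exists_coe_isSquare_inv_mul_and_valued_eq_exp_odd`, `not_isSquare_of_valued_eq_exp_odd` (brings ★ `QuadraticCompletionAtNonsplitPlace`: `numberField_adjoinRoot`, …)
import Literature.NumberTheory.Automorphic.SplitTorusOrderFixedSidePlace          -- ★ Σ2-CM this seat (g25): `exists_isUnit_galAdicCompletionMap_sub` (the `hmove` of ★ inert unit norms), residue cards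
import Literature.NumberTheory.LocalFields.UnramifiedQuadraticNormAtInertPlace    -- ★ `UnramifiedQuadraticNorm.exists_mul_map_eq_of_isUnit_integer`
import Literature.NumberTheory.Automorphic.Liu2021.LemD1AsPrintedIndexedNonVacuityInertCofinite   -- ★ `valued_toPlace_of_isUnramifiedIn`
import Literature.NumberTheory.Rogawski1990.TypeTwoUnitIndexAtPlace               -- ★ (D5) F0P3a-p08 (g18) ∕ p04 (g17): `exists_integers_relIndex_units_comap_norm_eq_place` ([T2-c] ★ p846601 discharged at the CM place)
import HarnessLib

/-!
# The depth-zero κ-transfer, type (2): ROW 2 at ONE PLACE — the number of self-dual `τ`-cyclic lattices of a type-(2) unitary `τ`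

Topic `NumberTheory/Rogawski1990`; namespace `Literature.NumberTheory.Rogawski1990`.  THEOREMS ONLY (no definition, no instance, no notation, no named fact, no `sorry`); kernel lane
`--supports stmt-HodgeConjecture-24833`.  Road «S3-tree», T3′ «DEPTH-ZERO κ-TRANSFER», P-2 row (R2²) «THE FREE ROW, TYPE (2)» (holder: this seat; architect A-p16 (g30) A-145∕A-152∕A-158).

THE MATHEMATICS (Rogawski §4.9, proof of Lemma 4.9.3 for a type-(2) class; Kottwitz §3; Jacobowitz §5, §7).  `E = L_w` the CM completion at an inert place `w ∣ v` away from `2`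
(`σ = σ_w`), `J` a hyperspecial `σ`-hermitian form, `τ ∈ U(σ,J)(E)` deep of type (2): `χ_τ = (X − u)(X² − tX + D)` with `X² − tX + D` irreducible over `E`, `ord_E(u² − tu + D) = n`,
`ord_E(t² − 4D) = 2N + 1`.  The regular-nilpotent stratum of the fixed cosets of `τ` in `U(E)∕U(𝒪)` is the set of SELF-DUAL `τ`-CYCLIC lattices `L(w) = ⊕ 𝒪 τ^k w` (★ rider); by ★ [T2-a] it
is a torsor under `C∕R^×` (`R = 𝒪[τ] ≅ 𝒪_E[(u, λ₁)] ≤ E × K`, `K = E(√disc) = E(λ₁)` the RAMIFIED eigen-field, `C = {c : c c⋆ ∈ R^×}`) as soon as it is non-empty, and `[C : R^×] =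
(q+1)q^{N+n−1}` (★ [T2-c] + ★ (D5)); by ★ [T2-b] (frame ∘ seam ∘ core, ★ (D2-γ-CM)) it is non-empty iff `ord_E d₀ + n` is even, `d₀ = ᵗσ(x₀) J x₀` the Gram value of the rational
`u`-eigenvector.  Hence **`#S(τ) = (q+1)q^{N+n−1}` if `ord_E d₀ + n` is even, `0` otherwise** (`ncard_selfDual_cyclic_typeTwo_eq_ite`); the eigen-field `K` is realised as the completion
`M_{w₁}` of the global quadratic field `M = L(√m)` (★ Q3, ★ QM) so that ★ (D2-β) applies (`ncard_selfDual_cyclic_typeTwo_eq_ite_of_model`).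
HONEST LABEL: HC_CM is proved only modulo the 2 remaining named inputs (hLiu418 24832, h413 24833) until rung 0 closes; unconditional local algebra, count-neutral.

## References
* [Rogawski1990] J. D. Rogawski, *Automorphic Representations of Unitary Groups in Three Variables* (1990): §4.9 Lemma 4.9.3 p. 56, Prop. 4.9.1 (b) p. 55.
* [Kottwitz1986] R. E. Kottwitz, *Base change for unit elements of Hecke algebras*, Compositio Math. 60 (1986): §3.
* [Jacobowitz1962] R. Jacobowitz, *Hermitian forms over local fields*, Amer. J. Math. 84 (1962): §5, §7.
* [SerreLocalFields1979] J.-P. Serre, *Local Fields*, GTM 67 (1979): Ch. V §2 Prop. 3.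
-/

set_option autoImplicit false

noncomputable section

open NumberField IsDedekindDomain Matrix Polynomial Finset
open scoped MatrixGroups WithZero ValuativeRel



namespace Literature.NumberTheory.Rogawski1990

open ValuativeRel
open Literature.NumberTheory.Automorphic Literature.NumberTheory.Automorphic.UnitaryGroup

open Literature.NumberTheory.GaloisRepresentations Literature.NumberTheory.NumberFields

variable (L : Type) [Field L] [NumberField L] [IsCMField L] {v : HeightOneSpectrum (𝓞 ↥(maximalRealSubfield L))}

set_option synthInstance.maxHeartbeats 200000 in
set_option maxHeartbeats 1600000 in
/-- **ROW 2 AT ONE PLACE, GIVEN A GLOBAL MODEL OF THE EIGEN-FIELD.**  For a type-(2) unitary `τ` over the CM completion `E = L_w` (inert `w ∣ v ∤ 2`, `J` hyperspecial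
`σ_w`-hermitian; `χ_τ = (X − u)(X² − tX + D)`, `σu·u = 1`, `DσD = 1`, `σt = tσD`, `u ≡ 1`, `t ≡ 2`, `ord(u² − tu + D) = n`, `4D = t² − y²·ι k₀` with `k₀` a uniformiser of `L⁺_v`,
`σy = −yσD`, `ord y = N`, `1 ≤ N + n`; cyclic vector `w₀`, rational `u`-eigenvector `x₀`), and a quadratic number field `M ⊃ L` whose completion at `w₁ ∣ w` is `L_w(√(ι k₀))`
(`c₁ δ₁ = −δ₁`, `m = δ₁²`, `(ι k₀)⁻¹ m ∈ (L_w^×)²`): the number of self-dual `τ`-cyclic lattices is `(q+1)·q^{N+n−1}` if `ord_w d₀ + n` is even (`d₀ = ᵗσ(x₀)·J·x₀`) and `0` otherwise.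
[cite: Rogawski1990, §4.9 Lemma 4.9.3 p. 56, Prop. 4.9.1 (b) p. 55] [cite: Kottwitz1986, §3] [cite: Jacobowitz1962, §5, §7] -/
theorem ncard_selfDual_cyclic_typeTwo_eq_ite_of_model (w : PlacesOver L v) (hw : IsCMField.complexConj L • w.1 = w.1)
    (hv : Algebra.IsUnramifiedIn (𝓞 L) v.asIdeal) (hv2 : Valued.v (2 : w.1.adicCompletion L) = 1)
    (J : GL (Fin 3) (w.1.adicCompletion L)) (hJ : J ∈ glInt 3 (w.1.adicCompletion L))
    (hJh : ((J : Matrix (Fin 3) (Fin 3) (w.1.adicCompletion L)).map (galAdicCompletionMap (L := L) (IsCMField.complexConj L) hw))ᵀ = J)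
    (τ : Matrix (Fin 3) (Fin 3) (w.1.adicCompletion L))
    (hτU : (τ.map (galAdicCompletionMap (L := L) (IsCMField.complexConj L) hw))ᵀ * (J : Matrix (Fin 3) (Fin 3) (w.1.adicCompletion L)) * τ = J)
    (hint : ∀ i, τ.charpoly.coeff i ∈ 𝒪[w.1.adicCompletion L])
    {u t D : w.1.adicCompletion L} (hχ : τ.charpoly = (X - C u) * (X ^ 2 - C t * X + C D))
    (hσu : galAdicCompletionMap (L := L) (IsCMField.complexConj L) hw u * u = 1)
    (hσD : D * galAdicCompletionMap (L := L) (IsCMField.complexConj L) hw D = 1)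
    (hσt : galAdicCompletionMap (L := L) (IsCMField.complexConj L) hw t = t * galAdicCompletionMap (L := L) (IsCMField.complexConj L) hw D)
    (hu1 : Valued.v (u - 1) < 1) (ht2 : Valued.v (t - 2) < 1)
    {n N : ℕ} (hn : Valued.v (u * u - t * u + D) = WithZero.exp (-(n : ℤ))) (hNn : 1 ≤ N + n)
    {w₀ : Fin 3 → w.1.adicCompletion L} (hK : IsUnit (Matrix.of fun i j : Fin 3 => ((τ ^ (j : ℕ)) *ᵥ w₀) i).det)
    {x₀ : Fin 3 → w.1.adicCompletion L} (hx₀ : τ *ᵥ x₀ = u • x₀) (hx₀0 : x₀ ≠ 0)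
    {y : w.1.adicCompletion L} {k₀ : v.adicCompletion ↥(maximalRealSubfield L)} (hk₀ : Valued.v k₀ = WithZero.exp (-1 : ℤ))
    (hD : 4 * D = t * t - y * y * toPlace v w k₀)
    (hσy : galAdicCompletionMap (L := L) (IsCMField.complexConj L) hw y = -(y * galAdicCompletionMap (L := L) (IsCMField.complexConj L) hw D))
    (hN : Valued.v y = WithZero.exp (-(N : ℤ)))
    {M : Type} [Field M] [NumberField M] [Algebra L M] [Algebra.IsQuadraticExtension L M] (c₁ : M ≃ₐ[L] M) {δ₁ : M} (hcδ : c₁ δ₁ = -δ₁) (hδ₁ : δ₁ ≠ 0)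
    {m : L} (hm : algebraMap L M m = δ₁ ^ 2) (hdm : IsSquare ((toPlace v w k₀)⁻¹ * (m : w.1.adicCompletion L))) (w₁ : PlacesOver M w.1) :
    {Λ : Submodule 𝒪[w.1.adicCompletion L] (Fin 3 → w.1.adicCompletion L) |
        (∃ g ∈ unitaryGroupOfForm (galAdicCompletionMap (L := L) (IsCMField.complexConj L) hw) (J : Matrix (Fin 3) (Fin 3) (w.1.adicCompletion L)),
          Λ = Submodule.span 𝒪[w.1.adicCompletion L] (Set.range ((g : Matrix (Fin 3) (Fin 3) (w.1.adicCompletion L)))ᵀ)) ∧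
        ∃ wv : Fin 3 → w.1.adicCompletion L, Λ = Submodule.span 𝒪[w.1.adicCompletion L] (Set.range fun j : Fin 3 => (τ ^ (j : ℕ)) *ᵥ wv)}.ncard =
      if Even (WithZero.log (Valued.v (∑ k, ∑ i, galAdicCompletionMap (L := L) (IsCMField.complexConj L) hw (x₀ i) *
            (J : Matrix (Fin 3) (Fin 3) (w.1.adicCompletion L)) i k * x₀ k)) + n) then
        (Ideal.absNorm v.asIdeal + 1) * Ideal.absNorm v.asIdeal ^ (N + n - 1) else 0 := by
  classical
  haveI : Algebra.IsQuadraticExtension ↥(maximalRealSubfield L) L := IsCMField.isQuadraticExtension L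
  have hc1 : IsCMField.complexConj L ≠ 1 := IsCMField.complexConj_ne_one L
  -- tokens at `w`: the inert dictionary (★ Σ2-CM, ★ (D2-α))
  set σw := galAdicCompletionMap (L := L) (IsCMField.complexConj L) hw with hσw_def
  have hσσ := galAdicCompletionMap_galAdicCompletionMap_of_smul_eq (IsCMField.complexConj L) w hc1 hw
  have hσO := mem_integer_galAdicCompletionMap (IsCMField.complexConj L) v w hw
  have hmoveU := Automorphic.exists_isUnit_galAdicCompletionMap_sub (IsCMField.complexConj L) v hc1 hv w hw
  have hmove := LocalFields.exists_isUnit_galAdicCompletionMap_sub L v w hw hv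
  have hσv := valuation_galAdicCompletionMap_eq (IsCMField.complexConj L) v w hw
  have hσv' : ∀ x, Valued.v (σw x) = Valued.v x := fun x => (v_eq_iff_valuation_eq _ _).2 (hσv x)
  have hnormF := LocalFields.exists_mul_galAdicCompletionMap_mul_eq_one_of_even L v w hw hv
  obtain ⟨u₁, f₁, hσu₁, hu₁v, -⟩ := LocalFields.exists_skew_unit L v w hw hv
  have e2 : ((2 : 𝒪[w.1.adicCompletion L]) : w.1.adicCompletion L) = 2 := map_ofNat (𝒪[w.1.adicCompletion L]).subtype 2
  have h20 : (2 : w.1.adicCompletion L) ≠ 0 := by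
    intro h; rw [h, map_zero] at hv2; exact zero_ne_one hv2
  have h2 : IsUnit (2 : 𝒪[w.1.adicCompletion L]) := by
    rw [Valuation.Integers.isUnit_iff_valuation_eq_one (Valuation.integer.integers (ValuativeRel.valuation (w.1.adicCompletion L))), map_ofNat]
    exact (v_eq_one_iff_valuation_eq_one _).1 hv2
  have htr : ∃ b : 𝒪[w.1.adicCompletion L], (b : w.1.adicCompletion L) + σw b = 1 := by
    refine ⟨↑(h2.unit⁻¹), ?_⟩
    have hb : (2 : w.1.adicCompletion L) * ((↑(h2.unit⁻¹) : 𝒪[w.1.adicCompletion L]) : w.1.adicCompletion L) = 1 := by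
      have h' := congrArg (fun z : 𝒪[w.1.adicCompletion L] => (z : w.1.adicCompletion L)) h2.mul_val_inv
      simp only [MulMemClass.coe_mul, OneMemClass.coe_one, e2] at h'
      exact h'
    have hσb : σw (((↑(h2.unit⁻¹) : 𝒪[w.1.adicCompletion L]) : w.1.adicCompletion L)) =
        ((↑(h2.unit⁻¹) : 𝒪[w.1.adicCompletion L]) : w.1.adicCompletion L) := by
      have h' := congrArg σw hb
      rw [map_mul, map_ofNat, map_one] at h'
      exact mul_left_cancel₀ h20 (h'.trans hb.symm)
    rw [hσb]; linear_combination hb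
  have hnorm : ∀ u : 𝒪[w.1.adicCompletion L], IsUnit u → σw u = u → ∃ s : 𝒪[w.1.adicCompletion L], (s : w.1.adicCompletion L) * σw s = u :=
    fun u hu hσu => LocalFields.UnramifiedQuadraticNorm.exists_mul_map_eq_of_isUnit_integer σw hσσ hσO hmoveU u hu hσu
  -- `d = ι k₀`: a `σ_w`-fixed uniformiser of `L_w`
  have hdv : Valued.v (toPlace v w k₀) = WithZero.exp (-1 : ℤ) := by
    rw [Liu2021.LemD1IndexedNonVacuityInertCofinite.valued_toPlace_of_isUnramifiedIn L v hv w, hk₀]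
  have hσd : σw (toPlace v w k₀) = toPlace v w k₀ := galAdicCompletionMap_toPlace (IsCMField.complexConj L) w w hw k₀
  have hdnsq : ¬ IsSquare (toPlace v w k₀) :=
    not_isSquare_of_valued_eq_exp_odd (-1) (by rw [hdv]; norm_num)
  -- elementary consequences of the eigen-data
  have hy0 : y ≠ 0 := fun h0 => by rw [h0, map_zero] at hN; exact WithZero.zero_ne_coe hN
  have hu0 : u ≠ 0 := fun h0 => by rw [h0, mul_zero] at hσu; exact zero_ne_one hσu
  have hD0 : D ≠ 0 := fun h0 => by rw [h0, zero_mul] at hσD; exact zero_ne_one hσD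
  have hχu : u * u - t * u + D ≠ 0 := fun h0 => by rw [h0, map_zero] at hn; exact WithZero.zero_ne_coe hn
  have hirr : ∀ x : w.1.adicCompletion L, x * x - t * x + D ≠ 0 := by
    intro x hx
    refine hdnsq ⟨(2 * x - t) / y, ?_⟩
    field_simp
    linear_combination hD - 4 * hx
  set e₂ : w.1.adicCompletion L := 2⁻¹ with he₂
  have h2e : e₂ * 2 = 1 := inv_mul_cancel₀ h20
  have hτu : IsUnit τ.det := by
    rw [isUnit_iff_ne_zero, Matrix.det_eq_sign_charpoly_coeff, Polynomial.coeff_zero_eq_eval_zero, hχ]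
    simp only [eval_mul, eval_sub, eval_add, eval_X, eval_C, eval_pow, Fintype.card_fin]
    have : (-1 : w.1.adicCompletion L) ^ 3 * ((0 - u) * (0 ^ 2 - t * 0 + D)) = u * D := by ring
    rw [this]
    exact mul_ne_zero hu0 hD0
  have hfτ : aeval τ (C 1 * X ^ 3 + C (-(t + u)) * X ^ 2 + C (D + t * u) * X + C (-(u * D))) = 0 := by
    have h := Matrix.aeval_self_charpoly τ
    rw [hχ] at h
    have hf : (C 1 * X ^ 3 + C (-(t + u)) * X ^ 2 + C (D + t * u) * X + C (-(u * D)) : (w.1.adicCompletion L)[X]) =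
        (X - C u) * (X ^ 2 - C t * X + C D) := by
      simp only [map_one, map_neg, map_add, map_mul, one_mul]
      ring
    rw [hf]
    exact h
  -- ★ (D2-β): the eigen-field package at `w₁`
  obtain ⟨θ, s', ι', ⟨hθ, hθv, hcoord, hintK⟩, ⟨hs'ι, hs'θ, hs's', hs'O, hs'v⟩, ⟨hι'ι, hι'θ, hι'ι', hι'O, hι'v, hcomm⟩,
      ⟨hquad, hlamO, hlam1, hnorm1, hι'lam, hne, hexpn, hexpN⟩, ⟨hrE, hnK, hnE⟩⟩ :=
    exists_eigenField_package M w.1 c₁ hcδ hδ₁ hm hdv hdm w₁ σw hσσ hσd hσv' hmove hnormF u t D y e₂ h2e hv2 hD hσD hσt hσy hn hN ht2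
  have hs'v' : ∀ z, valuation (w₁.1.adicCompletion M) (s' z) = valuation (w₁.1.adicCompletion M) z :=
    fun z => (v_eq_iff_valuation_eq _ _).1 (hs'v z)
  -- the ramified embedding `ι₁ = toPlace w w₁`
  have he : (w.1).asIdeal.ramificationIdx' w₁.1.asIdeal = 2 := ramificationIdx'_eq_two_of_uniformizer M w.1 c₁ hcδ hδ₁ hm hdv hdm w₁
  have hjv : ∀ x, Valued.v (toPlace w.1 w₁ x) = Valued.v x ^ 2 := valued_toPlace_of_ramificationIdx'_eq_two M w.1 w₁ he
  -- ★ (D2-γ-CM): non-emptiness ⟺ parity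
  have hgood := SymmetricEigenframe.exists_selfDual_cyclic_iff_even_log σw hσσ hσO htr hnorm hσu₁ hu₁v hv2 J hJ hJh τ hτU hχ hσu hu1
    hx₀ hx₀0 (toPlace w.1 w₁) hjv s' ι' hs'ι hs's' hs'v hι'ι hι'ι' hι'v hcomm hθv hι'θ hcoord hquad hlamO hlam1 hnorm1 hne hexpn hexpN hrE hnK hnE
  by_cases hex : ∃ wv : Fin 3 → w.1.adicCompletion L, ∃ g ∈ unitaryGroupOfForm σw (J : Matrix (Fin 3) (Fin 3) (w.1.adicCompletion L)),
      Submodule.span 𝒪[w.1.adicCompletion L] (Set.range fun k : Fin 3 => (τ ^ (k : ℕ)) *ᵥ wv) =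
        Submodule.span 𝒪[w.1.adicCompletion L] (Set.range ((g : Matrix (Fin 3) (Fin 3) (w.1.adicCompletion L)))ᵀ)
  swap
  · -- EMPTY CASE
    rw [if_neg (fun h => hex (hgood.2 h))]
    have hS : {Λ : Submodule 𝒪[w.1.adicCompletion L] (Fin 3 → w.1.adicCompletion L) |
        (∃ g ∈ unitaryGroupOfForm σw (J : Matrix (Fin 3) (Fin 3) (w.1.adicCompletion L)),
          Λ = Submodule.span 𝒪[w.1.adicCompletion L] (Set.range ((g : Matrix (Fin 3) (Fin 3) (w.1.adicCompletion L)))ᵀ)) ∧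
        ∃ wv : Fin 3 → w.1.adicCompletion L, Λ = Submodule.span 𝒪[w.1.adicCompletion L] (Set.range fun j : Fin 3 => (τ ^ (j : ℕ)) *ᵥ wv)} = ∅ := by
      ext Λ
      simp only [Set.mem_setOf_eq, Set.mem_empty_iff_false, iff_false, not_and]
      rintro ⟨g, hg, hΛg⟩ ⟨wv, hΛw⟩
      exact hex ⟨wv, g, hg, hΛw.symm.trans hΛg⟩
    rw [hS, Set.ncard_empty]
  -- NON-EMPTY CASE: the torsor count
  rw [if_pos (hgood.1 hex)]
  have hσu' : u * σw u = 1 := by rw [mul_comm]; exact hσu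
  -- ★ (D3): the bridge `φ : L_w × K →ₐ M₃(L_w)`
  letI : Algebra (w.1.adicCompletion L) (w₁.1.adicCompletion M) := (toPlace w.1 w₁).toAlgebra
  have halg : algebraMap (w.1.adicCompletion L) (w₁.1.adicCompletion M) = toPlace w.1 w₁ := RingHom.algebraMap_toAlgebra _
  set lam : w₁.1.adicCompletion M := (toPlace w.1 w₁ t + toPlace w.1 w₁ y * θ) * toPlace w.1 w₁ e₂ with hlam_def
  have hlam' : lam ^ 2 - algebraMap (w.1.adicCompletion L) (w₁.1.adicCompletion M) t * lam +
      algebraMap (w.1.adicCompletion L) (w₁.1.adicCompletion M) D = 0 := by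
    rw [halg]; exact hquad
  have hι2 : toPlace w.1 w₁ e₂ * 2 = 1 := by rw [← map_ofNat (toPlace w.1 w₁) 2, ← map_mul, h2e, map_one]
  have hιy : toPlace w.1 w₁ y ≠ 0 := (_root_.map_ne_zero _).2 hy0
  have hcoordlam : ∀ z : w₁.1.adicCompletion M, ∃ p q : w.1.adicCompletion L,
      z = algebraMap (w.1.adicCompletion L) (w₁.1.adicCompletion M) p + algebraMap (w.1.adicCompletion L) (w₁.1.adicCompletion M) q * lam := by
    intro z
    obtain ⟨pq, hpq, -⟩ := hcoord z
    refine ⟨pq.1 - pq.2 * t / y, 2 * pq.2 / y, ?_⟩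
    rw [halg, hpq, hlam_def, map_sub, map_div₀, map_mul, map_div₀, map_mul, map_ofNat]
    field_simp
    linear_combination (-(toPlace w.1 w₁ pq.2 * θ * toPlace w.1 w₁ y + toPlace w.1 w₁ pq.2 * toPlace w.1 w₁ t)) * hι2
  obtain ⟨φ, hφ, hφx⟩ := exists_algHom_prod u t D lam τ hfτ hK hlam' hirr hχu hcoordlam
  -- the adjoint relation (★ (D3) `hstar_of_algHom_prod`)
  have hσK : ∀ x, s' (algebraMap (w.1.adicCompletion L) (w₁.1.adicCompletion M) x) =
      algebraMap (w.1.adicCompletion L) (w₁.1.adicCompletion M) (σw x) := by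
    intro x; rw [halg]; exact hs'ι x
  have hx1 : ((u, lam) : w.1.adicCompletion L × w₁.1.adicCompletion M) * (σw u, s' lam) = 1 :=
    Prod.ext hσu' hnorm1
  have hall := exists_aeval_prod_eq u t D lam hχu hcoordlam hlam'
  have hstar := hstar_of_algHom_prod u lam σw s' hσK τ (J : Matrix (Fin 3) (Fin 3) (w.1.adicCompletion L)) hτU hτu hx1 hall φ hφx
  -- ★ (D5): the integral order and its index
  obtain ⟨ιO, σO, jO, σ₁O, uO, tO, yO, DO, e₂O, lamO, -, hσOc, hjOc, hσ₁Oc, huO, -, -, -, -, hlamO', hidx⟩ :=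
    exists_integers_relIndex_units_comap_norm_eq_place (IsCMField.complexConj L) v hc1 hv w hw hv2 w₁ hk₀ s' hθ hcoord hintK hs'ι hs'θ hs's' hs'O hs'v hnK
      u t D y e₂ hu1 ht2 h2e hD hσu' hσD hσt hσy hn hN hNn
  -- the order `RB = incl R` and `φ(RB) = 𝒪[τ]` (★ (D3) `mem_adjoin_integer_iff_exists_mem_map`)
  have hjO' : ∀ x : 𝒪[w.1.adicCompletion L], ((jO x : 𝒪[w₁.1.adicCompletion M]) : w₁.1.adicCompletion M) =
      algebraMap (w.1.adicCompletion L) (w₁.1.adicCompletion M) x := by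
    intro x; rw [halg]; exact hjOc x
  have hφx' : φ ((((uO : 𝒪[w.1.adicCompletion L]) : w.1.adicCompletion L), ((lamO : 𝒪[w₁.1.adicCompletion M]) : w₁.1.adicCompletion M)) :
      w.1.adicCompletion L × w₁.1.adicCompletion M) = τ := by
    rw [huO, hlamO']; exact hφx
  have hRB := mem_adjoin_integer_iff_exists_mem_map jO hjO' uO lamO τ φ hφx'
  -- a good unit `b₀` from the non-empty set (★ [T2-a] `exists_units_of_mem`)
  obtain ⟨wv, g, hg, hwg⟩ := hex
  obtain ⟨b₀, hb₀, -⟩ := exists_units_of_mem σw J τ hK φ hφ ((u, lam) : w.1.adicCompletion L × w₁.1.adicCompletion M) hφx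
    (Λ := Submodule.span 𝒪[w.1.adicCompletion L] (Set.range ((g : Matrix (Fin 3) (Fin 3) (w.1.adicCompletion L)))ᵀ)) ⟨⟨g, hg, rfl⟩, wv, hwg.symm⟩
  -- ★ [T2-a]: the torsor count, then ★ (D3): transport of the index to `𝒪_w × 𝒪[K]`
  rw [← hidx, ncard_setOf_selfDual_cyclic_eq_relIndex σw hσσ hσO htr hnorm J hJ hJh τ hint hK φ hφ
    ((u, lam) : w.1.adicCompletion L × w₁.1.adicCompletion M) hφx (RingHom.prodMap σw s') hstar _ hRB b₀ hb₀]
  exact relIndex_units_map_prod_eq jO uO lamO σO σw hσOc σ₁O s' hσ₁Oc hσv hs'v'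

set_option synthInstance.maxHeartbeats 200000 in
set_option maxHeartbeats 800000 in
/-- **ROW 2 AT ONE PLACE — THE NUMBER OF SELF-DUAL `τ`-CYCLIC LATTICES OF A TYPE-(2) UNITARY `τ`.**  For `τ` over the CM completion `E = L_w` at an inert place `w ∣ v ∤ 2`
(`J` hyperspecial `σ_w`-hermitian; `χ_τ = (X − u)(X² − tX + D)` with integral coefficients, `σu·u = 1`, `DσD = 1`, `σt = tσD`, `u ≡ 1`, `t ≡ 2 (mod 𝔪_w)`,
`ord_w(u² − tu + D) = n`, `ord_w(t² − 4D) = 2N + 1`, `1 ≤ N + n`; a cyclic vector `w₀` and a rational `u`-eigenvector `x₀`):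
`#{Λ : Λ = Λ(g) self-dual (g ∈ U(σ_w,J)) ∧ Λ = ⊕ 𝒪 τ^k w} = (q+1)·q^{N+n−1}` if `ord_w d₀ + n` is even, `d₀ = ᵗσ(x₀)·J·x₀`, and `0` otherwise (`q = N(v)`).  The ramified
eigen-field `L_w(√(t² − 4D))` is realised as the completion of the global `M = L(√m)` (★ Q3 `exists_coe_isSquare_inv_mul_and_valued_eq_exp_odd`, ★ QM) and
`ncard_selfDual_cyclic_typeTwo_eq_ite_of_model` applies. [cite: Rogawski1990, §4.9 Lemma 4.9.3 p. 56, Prop. 4.9.1 (b) p. 55] [cite: Kottwitz1986, §3] [cite: Jacobowitz1962, §5, §7] -/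
theorem ncard_selfDual_cyclic_typeTwo_eq_ite (w : PlacesOver L v) (hw : IsCMField.complexConj L • w.1 = w.1)
    (hv : Algebra.IsUnramifiedIn (𝓞 L) v.asIdeal) (hv2 : Valued.v (2 : w.1.adicCompletion L) = 1)
    (J : GL (Fin 3) (w.1.adicCompletion L)) (hJ : J ∈ glInt 3 (w.1.adicCompletion L))
    (hJh : ((J : Matrix (Fin 3) (Fin 3) (w.1.adicCompletion L)).map (galAdicCompletionMap (L := L) (IsCMField.complexConj L) hw))ᵀ = J)
    (τ : Matrix (Fin 3) (Fin 3) (w.1.adicCompletion L))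
    (hτU : (τ.map (galAdicCompletionMap (L := L) (IsCMField.complexConj L) hw))ᵀ * (J : Matrix (Fin 3) (Fin 3) (w.1.adicCompletion L)) * τ = J)
    (hint : ∀ i, τ.charpoly.coeff i ∈ 𝒪[w.1.adicCompletion L])
    {u t D : w.1.adicCompletion L} (hχ : τ.charpoly = (X - C u) * (X ^ 2 - C t * X + C D))
    (hσu : galAdicCompletionMap (L := L) (IsCMField.complexConj L) hw u * u = 1)
    (hσD : D * galAdicCompletionMap (L := L) (IsCMField.complexConj L) hw D = 1)
    (hσt : galAdicCompletionMap (L := L) (IsCMField.complexConj L) hw t = t * galAdicCompletionMap (L := L) (IsCMField.complexConj L) hw D)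
    (hu1 : Valued.v (u - 1) < 1) (ht2 : Valued.v (t - 2) < 1)
    {n N : ℕ} (hn : Valued.v (u * u - t * u + D) = WithZero.exp (-(n : ℤ)))
    (hdisc : Valued.v (t ^ 2 - 4 * D) = WithZero.exp (-((2 * N + 1 : ℕ) : ℤ))) (hNn : 1 ≤ N + n)
    {w₀ : Fin 3 → w.1.adicCompletion L} (hK : IsUnit (Matrix.of fun i j : Fin 3 => ((τ ^ (j : ℕ)) *ᵥ w₀) i).det)
    {x₀ : Fin 3 → w.1.adicCompletion L} (hx₀ : τ *ᵥ x₀ = u • x₀) (hx₀0 : x₀ ≠ 0) :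
    {Λ : Submodule 𝒪[w.1.adicCompletion L] (Fin 3 → w.1.adicCompletion L) |
        (∃ g ∈ unitaryGroupOfForm (galAdicCompletionMap (L := L) (IsCMField.complexConj L) hw) (J : Matrix (Fin 3) (Fin 3) (w.1.adicCompletion L)),
          Λ = Submodule.span 𝒪[w.1.adicCompletion L] (Set.range ((g : Matrix (Fin 3) (Fin 3) (w.1.adicCompletion L)))ᵀ)) ∧
        ∃ wv : Fin 3 → w.1.adicCompletion L, Λ = Submodule.span 𝒪[w.1.adicCompletion L] (Set.range fun j : Fin 3 => (τ ^ (j : ℕ)) *ᵥ wv)}.ncard =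
      if Even (WithZero.log (Valued.v (∑ k, ∑ i, galAdicCompletionMap (L := L) (IsCMField.complexConj L) hw (x₀ i) *
            (J : Matrix (Fin 3) (Fin 3) (w.1.adicCompletion L)) i k * x₀ k)) + n) then
        (Ideal.absNorm v.asIdeal + 1) * Ideal.absNorm v.asIdeal ^ (N + n - 1) else 0 := by
  classical
  -- ★ (D2-α): `t² − 4D = y²·ι k₀`, `k₀` a uniformiser of `L⁺_v`, `σ_w y = −y σ_w D`, `ord_w y = N`
  obtain ⟨y, k₀, hk₀, hD, hσy, hN⟩ := LocalFields.exists_skew_sqrt_discriminant L v w hw hv hv2 hσD hσt hdisc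
  have hdv : Valued.v (toPlace v w k₀) = WithZero.exp (-1 : ℤ) := by
    rw [Liu2021.LemD1IndexedNonVacuityInertCofinite.valued_toPlace_of_isUnramifiedIn L v hv w, hk₀]
  -- ★ Q3: a global `m ∈ L` in the square class of `ι k₀`, of odd `w`-order; ★ QM: `M = L(√m)` with its involution
  obtain ⟨m, -, hsq, k', hmval⟩ := exists_coe_isSquare_inv_mul_and_valued_eq_exp_odd (v := w.1) hv2 (-1) (d := toPlace v w k₀)
    (by rw [hdv]; norm_num)
  have hnsq : ¬ IsSquare m := not_isSquare_of_not_isSquare_algebraMap m (not_isSquare_of_valued_eq_exp_odd k' hmval)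
  haveI : Fact (Irreducible (X ^ 2 - C m : L[X])) := ⟨irreducible_X_sq_sub_C_of_not_isSquare m hnsq⟩
  haveI : NumberField (AdjoinRoot (X ^ 2 - C m : L[X])) := numberField_adjoinRoot m
  haveI : Algebra.IsQuadraticExtension L (AdjoinRoot (X ^ 2 - C m : L[X])) := isQuadraticExtension_adjoinRoot m
  obtain ⟨c₁, hc₁, -⟩ := exists_algEquiv_root_eq_neg m
  have hδ0 : AdjoinRoot.root (X ^ 2 - C m : L[X]) ≠ 0 := root_X_sq_sub_C_ne_zero m
  have hmδ : algebraMap L (AdjoinRoot (X ^ 2 - C m : L[X])) m = (AdjoinRoot.root (X ^ 2 - C m : L[X])) ^ 2 := (root_X_sq_sub_C_sq m).symm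
  obtain ⟨w₁⟩ : Nonempty (PlacesOver (AdjoinRoot (X ^ 2 - C m : L[X])) w.1) := inferInstance
  have hdm : IsSquare ((toPlace v w k₀)⁻¹ * (m : w.1.adicCompletion L)) := hsq
  exact ncard_selfDual_cyclic_typeTwo_eq_ite_of_model L w hw hv hv2 J hJ hJh τ hτU hint hχ hσu hσD hσt hu1 ht2 hn hNn hK hx₀ hx₀0 hk₀ hD hσy hN
    c₁ hc₁ hδ0 hmδ hdm w₁

end Literature.NumberTheory.Rogawski1990

end
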